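import Literature.AlgebraicGeometry.AbelianSchemes.AbelianVarietyCechCupSurjective
import Literature.AlgebraicGeometry.AbelianSchemes.AbelianVarietyCechDiagonalMaps
import Literature.AlgebraicGeometry.AbelianSchemes.AbelianSchemeOverField
import Literature.AlgebraicGeometry.ProjectiveGeometry.AffineCoverOfCardDimSucc
import Literature.AlgebraicGeometry.Modules.CechOrderedRefinementComparison
import Literature.AlgebraicGeometry.Modules.CechComplexHOneCechH1
import Literature.Algebra.Bialgebra.DegreeOneIterCupNeZero
import HarnessLib

/-!
# `Ȟ¹(A, 𝒪) ⊗ Ȟ¹(A, 𝒪) ↠ Ȟ²(A, 𝒪)` for an abelian variety over ANY field, from the `H¹`-count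
# (Mumford AV §13 Cor. 2; Görtz–Wedhorn II Cor. 27.79 ∕ Cor. 27.200), ordered Čech

Layer `Literature/AlgebraicGeometry/AbelianSchemes`; namespace `Literature.AlgebraicGeometry.AbelianSchemes.AbelianVarietyCech`.
PROOF file (theorems only; no definition, no instance, no notation, no named fact, no `sorry`).

★ `AbelianVarietyCech.cup_one_one_surjective` proves `Ȟ¹ ∪ Ȟ¹ = Ȟ²` for an abelian variety `A` over a field `k` with
`[CharZero k]` (the Hopf-algebra POWER argument).  This file removes the characteristic hypothesis at the price of the
`H¹`-COUNT, through the «top-degree annihilation» road ★ `Bialgebra.cup_one_one_surjective_of_le_finrank` (top degree `N`,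
`1 ≠ 0` in `Ȟ⁰`, `N ≤ dim Ȟ¹ + 1`), instantiated on the ordered module Čech classes exactly as ★ `cup_one_one_surjective_of_covers`:

* §1 `homologyπ_unitCycle_ne_zero` — **`[1] ≠ 0` in `Ȟ⁰(U, 𝒪_A)`** (`Γ(A, 𝒪_A) = k` is a field; ★ `kerDZeroEquiv`).
* §2 `homology_eq_zero_of_dim_lt` — **`Ȟⁿ(U, 𝒪_A) = 0` for `n > dim A` on EVERY finite affine open cover `U`**: on the
  `(dim A + 1)`-member affine cover `U₀` of ★ `AbelianVariety.exists_affineCover_fin_dim_succ` the ordered complex stops in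
  degree `dim A` (★ `OrderedCech.eq_zero_of_card_le`), and the refinement maps `Ȟⁿ(U₀) → Ȟⁿ(U₀ ∩ U) ← Ȟⁿ(U)` to the common
  refinement are bijective (★ `homologyMap_refineComplexMap_pullbackSystemHom_id_bijective`, affine covers of the separated `A`).
* §3 HEAD `cup_one_one_surjective_of_covers_of_dim_le` ∕ `cup_one_one_surjective_of_dim_le` — **for an abelian variety `A` over
  ANY field `k`, a finite affine open cover `U` with `dim A ≤ dim_k Ȟ¹(U, 𝒪_A) + 1` (the `H¹`-count; e.g. `dim_k Ȟ¹ = dim A`,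
  [GortzWedhorn2023] (27.37.2) ∕ ★ `CechH1CountOfPoincareDataHead` for Poincaré∕DUALS data), the cup product
  `Ȟ¹(U, 𝒪_A) ⊗ Ȟ¹(U, 𝒪_A) → Ȟ²(U, 𝒪_A)` is SURJECTIVE** (the FULL-cochain form follows from ★ `exists_sum_cup_add_d_of_surjective`);
  §4 the same head with the count read in the all-ordered-pairs currency ★ `Morphisms.CechH1` of the `H¹`-count bricks
  (`finrank_cechH1_eq_finrank_homology_one`, `cup_one_one_surjective_of_dim_le_finrank_cechH1`).

Cell `hodgecm-mathlib` (D-0151), FLOOR 0 ∕ P6 (U)-road organ (G4) of the (U-ab) census (A-p12 MEMO v2 §5): generic, count-neutral —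
HC_CM is proved only modulo the 7 printed citations until rung 0 closes, and nothing here refers to it.

## References
* D. Mumford, *Abelian Varieties* (1970), §13 Theorem (p. 125) and Cor. 2 (p. 129). [MumfordAV1970]
* U. Görtz, T. Wedhorn, *Algebraic Geometry II* (2023), (21.29), Lemma 21.65 (p. 179), Thm. 22.9 (p. 236), Cor. 27.79, (27.37.2),
  Cor. 27.200. [GortzWedhorn2023]
* The Stacks Project, Tags 01XD, 0BEC. [StacksProject]
* R. Hartshorne, *Algebraic Geometry*, GTM 52 (1977), III Thm. 4.5 (p. 222), III Ex. 4.8 (p. 225). [Hartshorne1977]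
-/

noncomputable section

open CategoryTheory CategoryTheory.Limits CategoryTheory.MonoidalCategory AlgebraicGeometry TopologicalSpace Opposite
open HomologicalComplex TensorProduct Finset
open Literature.Algebra.Homology Literature.Algebra.Homology.OrderedCech Literature.AlgebraicGeometry.Modules
open Literature.AlgebraicGeometry.Morphisms Literature.AlgebraicGeometry.ProjectiveGeometry

set_option backward.isDefEq.respectTransparency false

namespace Literature.AlgebraicGeometry.AbelianSchemes.AbelianVarietyCech

universe u

/-! ## §1 `[1] ≠ 0` in `Ȟ⁰(U, 𝒪_A)` -/

section UnitClass

variable {k : Type} [Field k] (A : AbelianSchemeOver (Spec (.of k)))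
  {ι : Type} [LinearOrder ι] (U : ι → A.X.left.affineOpens) (hcov : ⨆ i, (U i).1 = ⊤)

include hcov in
/-- **The unit class `[1] ∈ Ȟ⁰(U, 𝒪_A)` is non-zero** (the hypothesis `hone` of ★ `Bialgebra.cup_one_one_surjective_of_le_finrank`):
`Γ(A, 𝒪_A) = k` is a field (★ `AbelianSchemeOver.app_bijective_of_isArtinianRing`), and the augmentation `Γ(A, 𝒪_A) ≅ ker d⁰ = Z⁰ ≅ Ȟ⁰`
(★ `kerDZeroEquiv`, ★ `homologyπ_injective_of_le_zero`) sends `1` to the unit class. [cite: GortzWedhorn2023, Lemma 21.65 (p. 179)]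
[cite: MumfordAV1970, §13 Cor. 2 (p. 129)] -/
theorem homologyπ_unitCycle_ne_zero (eA : (CA A U).cycles ((0 : ℕ) : ℤ))
    (heA : ((CA A U).iCycles _).hom eA =
      (fun σ => unitFamily (U' A U) (ρ₁ A) σ.1 : SysCochain (sectionsSystem (U' A U) (unitModule A.X.left) (ρ₁ A)) ((0 : ℕ) : ℤ))) :
    ((CA A U).homologyπ _).hom eA ≠ 0 := by
  have hρ₁ : Function.Bijective (ρ₁ A) :=
    (A.app_bijective_of_isArtinianRing ⊤).comp (Scheme.ΓSpecIso (.of k)).commRingCatIsoToRingEquiv.symm.bijective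
  intro h0
  -- `π` is injective in degree `0`, so `eA = 0`
  have he0 : eA = 0 := by
    apply homologyπ_injective_of_le_zero (sectionsSystem (U' A U) (unitModule A.X.left) (ρ₁ A)) ((0 : ℕ) : ℤ) (by simp)
    rw [h0, map_zero]
  -- hence the unit cochain vanishes, i.e. the augmentation of `1 ∈ Γ(A, 𝒪_A)` vanishes
  have hunit : (fun σ => unitFamily (U' A U) (ρ₁ A) σ.1 :
      SysCochain (sectionsSystem (U' A U) (unitModule A.X.left) (ρ₁ A)) ((0 : ℕ) : ℤ)) = 0 := by
    rw [← heA, he0, map_zero]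
  have haug : (kerDZeroEquiv (U' A U) (unitModule A.X.left) (ρ₁ A) hcov (SecMod.ofRing (ρ₁ A) 1) :
      SysCochain (sectionsSystem (U' A U) (unitModule A.X.left) (ρ₁ A)) 0) = 0 := by
    rw [coe_kerDZeroEquiv_apply]
    refine (funext fun σ => (cechAugment_ofRing_one_apply (U' A U) (ρ₁ A) σ)).trans ?_
    exact hunit
  have hone : SecMod.ofRing (ρ₁ A) (1 : Γ(A.X.left, ⊤)) = 0 := by
    apply (kerDZeroEquiv (U' A U) (unitModule A.X.left) (ρ₁ A) hcov).injective
    rw [map_zero]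
    exact Subtype.ext haug
  -- but `1 ≠ 0` in `Γ(A, 𝒪_A) ≅ k`
  have h10 : (1 : Γ(A.X.left, ⊤)) = 0 := by
    have := congrArg (SecMod.toRing (ρ₁ A)) hone
    rwa [SecMod.toRing_ofRing, SecMod.toRing_zero] at this
  have hk : (ρ₁ A) 1 = (ρ₁ A) 0 := by rw [map_one, map_zero, h10]
  exact one_ne_zero (hρ₁.1 hk)

end UnitClass

/-! ## §2 `Ȟⁿ(U, 𝒪_A) = 0` above the dimension, on every finite affine cover -/

section TopDegree

variable {k : Type} [Field k] (A : AbelianSchemeOver (Spec (.of k)))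
  {ι : Type} [LinearOrder ι] [Fintype ι] (U : ι → A.X.left.affineOpens) (hcov : ⨆ i, (U i).1 = ⊤)

include hcov in
/-- **`Ȟⁿ(U, 𝒪_A) = 0` for `n > dim A` on every finite affine open cover `U` of an abelian variety `A` over a field.**
On the affine cover `U₀` with `dim A + 1` members (★ `AbelianVariety.exists_affineCover_fin_dim_succ`) the ordered Čech complex
has no `n`-cochains (★ `OrderedCech.eq_zero_of_card_le`); both refinement maps to the common refinement `(U₀ a ∩ U i)_{(a,i)}`
(affine: `A` is separated) are bijective on `Ȟⁿ` (★ `homologyMap_refineComplexMap_pullbackSystemHom_id_bijective`), so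
`Ȟⁿ(U) ≅ Ȟⁿ(U₀ ∩ U) ≅ Ȟⁿ(U₀) = 0`. [cite: MumfordAV1970, §13 Theorem (p. 125) and pp. 127–129] [cite: Hartshorne1977, III Ex. 4.8 (p. 225)]
[cite: StacksProject, Tag 01XD] [cite: GortzWedhorn2023, Thm. 22.9 (p. 236)] -/
theorem homology_eq_zero_of_dim_lt (n : ℕ) (hn : A.toAffine.toAbelianVariety.dim < n) (y : (CA A U).homology (n : ℤ)) : y = 0 := by
  classical
  haveI := isSeparated_X A
  haveI : IsSeparated A.X.hom := A.isProper.toIsSeparated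
  -- the `(dim A + 1)`-member affine cover
  obtain ⟨U₀, hU₀⟩ := AbelianVariety.exists_affineCover_fin_dim_succ A.toAffine.toAbelianVariety
  -- the common refinement `W (a, i) = U₀ a ∩ U i`, affine
  let W : Fin (A.toAffine.toAbelianVariety.dim + 1) ×ₗ ι → A.X.left.affineOpens := fun d =>
    ⟨(U₀ (ofLex d).1).1 ⊓ (𝟙 A.X.left : A.X.left ⟶ A.X.left) ⁻¹ᵁ (U (ofLex d).2).1,
      isAffineOpen_inf_preimage (Z := A.X) (𝟙 A.X.left) (U₀ (ofLex d).1).2 (U (ofLex d).2)⟩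
  haveI : Fintype (Fin (A.toAffine.toAbelianVariety.dim + 1) ×ₗ ι) :=
    inferInstanceAs (Fintype (Fin (A.toAffine.toAbelianVariety.dim + 1) × ι))
  have hWcov : ⨆ d, (W d).1 = ⊤ := by
    apply top_le_iff.mp
    intro x _
    have hx₀ : x ∈ (⊤ : A.X.left.Opens) := trivial
    have hx₁ : x ∈ (⊤ : A.X.left.Opens) := trivial
    rw [← hU₀] at hx₀
    rw [← hcov] at hx₁
    obtain ⟨a, ha⟩ := Opens.mem_iSup.mp hx₀
    obtain ⟨i, hi⟩ := Opens.mem_iSup.mp hx₁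
    exact Opens.mem_iSup.mpr ⟨toLex (a, i), ⟨ha, hi⟩⟩
  have hWa : ∀ s : Finset (Fin (A.toAffine.toAbelianVariety.dim + 1) ×ₗ ι), s.Nonempty → IsAffineOpen (cechOpen (U' A W) s) :=
    fun s hs => isAffineOpen_cechOpen_of_nonempty W hs
  have hU₀a : ∀ s : Finset (Fin (A.toAffine.toAbelianVariety.dim + 1)), s.Nonempty → IsAffineOpen (cechOpen (U' A U₀) s) :=
    fun s hs => isAffineOpen_cechOpen_of_nonempty U₀ hs
  have hρ : ∀ a, ρ₁ A a = (𝟙 A.X.left : A.X.left ⟶ A.X.left).appTop (ρ₁ A a) := fun a => by simp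
  -- `r_U : Ȟⁿ(U) → Ȟⁿ(W)` along `snd`, bijective
  have hθU : ∀ d, (W d).1 ≤ (𝟙 A.X.left : A.X.left ⟶ A.X.left) ⁻¹ᵁ (U' A U) (ofLex d).2 := fun d => inf_le_right
  have hrU := homologyMap_refineComplexMap_pullbackSystemHom_id_bijective (U' A U) (U' A W) (ρ₁ A) (fun d => (ofLex d).2)
    hθU hρ (hUa A U) hWa hcov hWcov (n : ℤ)
  -- `r_U₀ : Ȟⁿ(U₀) → Ȟⁿ(W)` along `fst`, bijective, with zero source
  have hθU₀ : ∀ d, (W d).1 ≤ (𝟙 A.X.left : A.X.left ⟶ A.X.left) ⁻¹ᵁ (U' A U₀) (ofLex d).1 := fun d => inf_le_left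
  have hrU₀ := homologyMap_refineComplexMap_pullbackSystemHom_id_bijective (U' A U₀) (U' A W) (ρ₁ A) (fun d => (ofLex d).1)
    hθU₀ hρ hU₀a hWa hU₀ hWcov (n : ℤ)
  -- `Ȟⁿ(W) = 0`
  have hW0 : ∀ w : (CA A W).homology (n : ℤ), w = 0 := fun w => by
    obtain ⟨y₀, rfl⟩ := hrU₀.2 w
    rw [OrderedCech.eq_zero_of_card_le (M := sectionsSystem (U' A U₀) (unitModule A.X.left) (ρ₁ A)) n
      (by rw [Fintype.card_fin]; omega) y₀, map_zero]
  -- `r_U` injective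
  apply hrU.1
  rw [map_zero]
  exact hW0 _

end TopDegree

/-! ## §3 HEAD — `Ȟ¹(U, 𝒪_A) ⊗ Ȟ¹(U, 𝒪_A) ↠ Ȟ²(U, 𝒪_A)` from the `H¹`-count, any characteristic -/

section Head

variable {k : Type} [Field k] (A : AbelianSchemeOver (Spec (.of k)))
  {ι : Type} [LinearOrder ι] [Fintype ι] (U : ι → A.X.left.affineOpens) (hcov : ⨆ i, (U i).1 = ⊤)
  (W₀ : ι ×ₗ ι → (X2 A).affineOpens)
  (hW₀ : ∀ i j, (W₀ (toLex (i, j))).1 = p₁ A ⁻¹ᵁ (U i).1 ⊓ p₂ A ⁻¹ᵁ (U j).1)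
  (W : (ι ×ₗ ι) ×ₗ ι → (X2 A).affineOpens)
  (hW : ∀ c l, (W (toLex (c, l))).1 = (W₀ c).1 ⊓ m A ⁻¹ᵁ (U l).1)
  (j₀ : ι) (hj₀ : e A ⁻¹ᵁ (U j₀).1 = ⊤)
  (hH1 : A.toAffine.toAbelianVariety.dim ≤ Module.finrank k ((CA A U).homology ((1 : ℕ) : ℤ)) + 1)

include hcov hW₀ hW hj₀ hH1 in
/-- **`Ȟ¹ ∪ Ȟ¹ = Ȟ²` for an abelian variety over ANY field, from the `H¹`-count, with the covers as binders.**  Same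
instantiation as ★ `cup_one_one_surjective_of_covers` (the seven maps of ★ `AbelianVarietyCechProductMaps` ∕ `…Composites`,
`Ȟ⁰ = k·[1]` ★ `exists_augmentation`, Künneth ★ `hinj` ∕ `hsurj`), fed to ★ `Bialgebra.cup_one_one_surjective_of_le_finrank`
with: `[1] ≠ 0` (§1), top degree `N := dim A` (§2 `homology_eq_zero_of_dim_lt`), and the count `dim A ≤ dim_k Ȟ¹(U, 𝒪_A) + 1`
(hypothesis `hH1`; in print `dim_k H¹(A, 𝒪_A) = dim A`). No characteristic hypothesis. [cite: MumfordAV1970, §13 Cor. 2 (p. 129)]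
[cite: GortzWedhorn2023, Cor. 27.79] [cite: GortzWedhorn2023, Cor. 27.200] -/
theorem cup_one_one_surjective_of_covers_of_dim_le :
    Function.Surjective (TensorProduct.lift (cupA A U 1 1 2 rfl)) := by
  classical
  have hρ₁ : Function.Bijective (ρ₁ A) :=
    (A.app_bijective_of_isArtinianRing ⊤).comp (Scheme.ΓSpecIso (.of k)).commRingCatIsoToRingEquiv.symm.bijective
  obtain ⟨eA, heA⟩ := exists_unitCycle (U' A U) (ρ₁ A)
  obtain ⟨eS, heS⟩ := exists_unitCycle (W₀' A W₀) (ρ₂ A)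
  obtain ⟨aug, haug⟩ := exists_augmentation (U' A U) (ρ₁ A) hcov hρ₁ eA heA
  haveI : Fintype (ι ×ₗ ι) := inferInstanceAs (Fintype (ι × ι))
  exact Literature.Algebra.Bialgebra.cup_one_one_surjective_of_le_finrank (k := k)
    (HA := fun n => (CA A U).homology (n : ℤ)) (HS := fun n => (CS A W₀).homology (n : ℤ))
    (cupA := cupA A U) (cupS := cupS A W₀) (m := mS A U hcov W₀ hW₀ W hW) (p₁ := pOne A U W₀ hW₀)
    (p₂ := pTwo A U W₀ hW₀) (i₁ := iOne A U W₀ hW₀ j₀ hj₀) (i₂ := iTwo A U W₀ hW₀ j₀ hj₀)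
    (oneA := ((CA A U).homologyπ _).hom eA) (oneS := ((CS A W₀).homologyπ _).hom eS) (aug := aug)
    (haug := haug)
    (hp₁_one := pOne_one A U W₀ hW₀ eA eS heA heS) (hp₂_one := pTwo_one A U W₀ hW₀ eA eS heA heS)
    (hm_one := mS_one A U hcov W₀ hW₀ W hW eA eS heA heS)
    (honeS_left := fun b y =>
      cupH_unit_left _ (unitFamily _ _) (unitFamily_compatible _ _) (mulPairing_unitFamily_left _ _) eS heS b y)
    (honeS_right := fun a y =>
      cupH_unit_right _ (unitFamily _ _) (unitFamily_compatible _ _) (mulPairing_unitFamily_right _ _) eS heS a y)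
    (honeA_left := fun b y =>
      cupH_unit_left _ (unitFamily _ _) (unitFamily_compatible _ _) (mulPairing_unitFamily_left _ _) eA heA b y)
    (hm_mul := mS_mul A U hcov W₀ hW₀ W hW) (hp₁_mul := pOne_mul A U W₀ hW₀) (hp₂_mul := pTwo_mul A U hcov W₀ hW₀)
    (hi₁_mul := iOne_mul A U W₀ hW₀ j₀ hj₀) (hi₂_mul := iTwo_mul A U W₀ hW₀ j₀ hj₀)
    (hi₁m := hi₁m A U hcov W₀ hW₀ W hW j₀ hj₀) (hi₂m := hi₂m A U hcov W₀ hW₀ W hW j₀ hj₀)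
    (hi₁p₁ := hi₁p₁ A U W₀ hW₀ j₀ hj₀) (hi₂p₂ := hi₂p₂ A U W₀ hW₀ j₀ hj₀)
    (hi₁p₂ := hi₁p₂ A U W₀ hW₀ j₀ hj₀) (hi₂p₁ := hi₂p₁ A U W₀ hW₀ j₀ hj₀)
    (hassoc := fun a b c ab bc n hab hbc h y z w =>
      cupH_assoc _ _ _ _ (mulPairing_assoc (W₀' A W₀) (ρ₂ A)) a b c ab bc n hab hbc h y z w)
    (hcomm := hcomm A U hcov W₀ hW₀)
    (hinj := fun κ s deg hdeg n t ht i hi hin => hinj A U hcov W₀ hW₀ κ s deg hdeg n t ht i hi hin)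
    (hsurj := hsurj A U hcov W₀ hW₀)
    (hone := homologyπ_unitCycle_ne_zero A U hcov eA heA)
    (N := A.toAffine.toAbelianVariety.dim)
    (hN := fun n hn y => homology_eq_zero_of_dim_lt A U hcov n hn y)
    (hdim := hH1)

end Head

section Heads

variable {k : Type} [Field k] (A : AbelianSchemeOver (Spec (.of k)))
  {ι : Type} [LinearOrder ι] [Fintype ι] (U : ι → A.X.left.affineOpens) (hcov : ⨆ i, (U i).1 = ⊤)
  (hH1 : A.toAffine.toAbelianVariety.dim ≤ Module.finrank k ((CA A U).homology ((1 : ℕ) : ℤ)) + 1)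

include hcov hH1 in
/-- **HEAD (any characteristic).**  For an abelian variety `A` over a field `k` and a finite affine open cover `U` with
`dim A ≤ dim_k Ȟ¹(U, 𝒪_A) + 1`, the cup product `Ȟ¹(U, 𝒪_A) ⊗ Ȟ¹(U, 𝒪_A) → Ȟ²(U, 𝒪_A)` of ordered module Čech classes is
SURJECTIVE (the auxiliary covers of `A × A` exist, ★ `exists_covers`). [cite: MumfordAV1970, §13 Cor. 2 (p. 129)]
[cite: GortzWedhorn2023, Cor. 27.79] [cite: GortzWedhorn2023, Cor. 27.200] -/
theorem cup_one_one_surjective_of_dim_le : Function.Surjective (TensorProduct.lift (cupA A U 1 1 2 rfl)) := by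
  obtain ⟨W₀, hW₀, W, hW, j₀, hj₀⟩ := exists_covers A U hcov
  exact cup_one_one_surjective_of_covers_of_dim_le A U hcov W₀ hW₀ W hW j₀ hj₀ hH1

end Heads

/-! ## §4 The head in the `CechH1` (all-ordered-pairs module Čech) currency of the `H¹`-count bricks -/

section CechH1Currency

variable {k : Type} [Field k] (A : AbelianSchemeOver (Spec (.of k)))
  {ι : Type} [LinearOrder ι] [Fintype ι] (U : ι → A.X.left.affineOpens) (hcov : ⨆ i, (U i).1 = ⊤)

omit [Fintype ι] in
/-- **Dictionary**: `dim_k Ȟ¹(U, 𝒪_A)` is the same number in the all-ordered-pairs currency ★ `Morphisms.CechH1 A.X.hom U` (the currency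
of the `H¹`-count bricks ★ `CechH1CountOfPoincareDataHead`, ★ `AbelianVarietyCechH1FieldBaseChange`) and in the ordered module Čech currency
`(CA A U).homology 1` of the cup product (★ `nonempty_cechH1_linearEquiv_HOne_cechComplex` + ★ `nonempty_HmkQ_linearEquiv_homology`).
[cite: StacksProject, Tag 01FM] [cite: GortzWedhorn2023, Def. 21.68 (p. 180)] -/
theorem finrank_cechH1_eq_finrank_homology_one :
    Module.finrank k (CechH1 A.X.hom (U' A U)) = Module.finrank k ((CA A U).homology ((1 : ℕ) : ℤ)) := by
  obtain ⟨e₁⟩ := nonempty_cechH1_linearEquiv_HOne_cechComplex A.X.hom (ρ₁ A) (fun _ => rfl) (U' A U)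
  obtain ⟨e₂⟩ := Literature.Algebra.Homology.nonempty_HmkQ_linearEquiv_homology
    (cechComplex (U' A U) (unitModule A.X.left) (ρ₁ A)) 0 1 2 (by norm_num) (by norm_num)
  exact (e₁.trans e₂).finrank_eq

include hcov in
/-- **HEAD, `CechH1` currency (any characteristic).**  For an abelian variety `A` over a field `k` and a finite affine open cover `U`
with `dim A ≤ dim_k Ȟ¹(U, 𝒪_A) + 1`, the count read in ★ `Morphisms.CechH1 A.X.hom U` (e.g. `dim_k Ȟ¹ = dim A` from ★
`CechH1CountOfPoincareDataHead.finite_finrank_cechH1_eq_dim_of_letter_field` for Poincaré∕DUALS-letter data), the cup product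
`Ȟ¹(U, 𝒪_A) ⊗ Ȟ¹(U, 𝒪_A) → Ȟ²(U, 𝒪_A)` is SURJECTIVE. [cite: MumfordAV1970, §13 Cor. 2 (p. 129)] [cite: GortzWedhorn2023, Cor. 27.79]
[cite: GortzWedhorn2023, Cor. 27.200] -/
theorem cup_one_one_surjective_of_dim_le_finrank_cechH1
    (hH1 : A.toAffine.toAbelianVariety.dim ≤ Module.finrank k (CechH1 A.X.hom (U' A U)) + 1) :
    Function.Surjective (TensorProduct.lift (cupA A U 1 1 2 rfl)) :=
  cup_one_one_surjective_of_dim_le A U hcov (by rw [← finrank_cechH1_eq_finrank_homology_one A U]; exact hH1)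

end CechH1Currency

end Literature.AlgebraicGeometry.AbelianSchemes.AbelianVarietyCech

end
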